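import Literature.Computability.QuantumComplexity.SwapDesc
import Literature.Computability.QuantumComplexity.CWrapUniform
import Literature.Computability.QuantumComplexity.ZoneGadgets
import Literature.Computability.Complexity.FoldCatBricks
import Literature.Computability.Complexity.StackBricksArith
import Literature.Computability.Complexity.BranchingFn
import HarnessLib

/-!
# Printing zone gadgets in polynomial time: bounded string functions

Toolkit for uniformity proofs of circuit families assembled from the zone gadgets of
`ZoneGadgets.lean` (`swapZ`, `notsZ`, `copyZ`) and Hadamard layers, at offsets that are
polynomial-time computable quantities of the family index but not polynomials of it (so that the
one-counter generator programs of `GenPrograms.lean` do not apply directly), written for the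
uniformity of Regev's per-copy routine (`Algebra/EuclideanLattices/RegevRoutineUniform.lean`).
Everything is printed at the string level, by the counted concatenation fold `foldCat` of
`FoldCatBricks.lean` over pieces built from the numeral bricks (`lenBinF`, `addFn`, `prodFn`,
`polyFn`):

* `BFn` — a string function **bundled** with its `FP` membership and a polynomial bound of its
  output length (`BFn.app`, `BFn.const`, `BFn.pre` — precomposition with a non-expanding `FP` map);
* `NExpr V` — numeral expressions `c | p(x) | a + b | a · b` over variables `x : V` read off the
  input by non-expanding projections `π` (`Proj`); `NExpr.toB π e : BFn` prints the binary numeral of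
  the value (`NExpr.toB_apply`); `ucount` — a unary count `1^{q(|π x|)}`;
* gate words on numerals: `gate1 s` (a one-wire Clifford+T gate), `hWord` (`= gateEnc (hOn ·)`),
  `notWord` (`= opBits (ClOp.not ·)`), `cnotWord`, `swapWord` (`opBits` of the three `CNOT`s);
* `BFn.layer F cnt` — **the layer** `x ↦ F ⟨x, 1⁰⟩ ++ ⋯ ++ F ⟨x, 1^{|cnt x| − 1}⟩` (a `ccat`, by `foldCat`
  with the clip and round polynomials read off the bundles: `BFn.layer_apply`);
* `flatMap_opBits_swapZ`, `flatMap_opBits_notsZ`, `flatMap_opBits_copyZ` — the gadgets of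
  `ZoneGadgets.lean` describe as such `ccat`s; `iteB` — branching on a length comparison.

(Arora–Barak 2009, §6.2 Def. 6.12 and Remark 6.7: descriptions printed in polynomial time; §1.3.)

## References

* S. Arora, B. Barak, *Computational Complexity: A Modern Approach*, CUP 2009, §1.3, §6.1, §6.2.
* M. A. Nielsen, I. L. Chuang, *Quantum Computation and Quantum Information*, CUP 2010, §1.3.4, §4.3.
-/

noncomputable section

namespace Literature.Computability.QuantumComplexity

open _root_.Computability Polynomial Complexity Complexity.Brick Complexity.OracleCompose Plumb RevDesc SProg ZoneGadgets

namespace GadgetDesc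

/-! ### Bundled bounded `FP` string functions -/

/-- A string function with its `FP` membership and a polynomial bound of its output length.
[cite: AroraBarak2009, §1.3 (polynomial-time functions compose)] -/
structure BFn where
  /-- the function -/
  fn : List Bool → List Bool
  /-- it is polynomial time -/
  mem : fn ∈ FP
  /-- a bound of the output length in the input length -/
  bd : Polynomial ℕ
  /-- the bound -/
  le : ∀ w, (fn w).length ≤ bd.eval w.length

/-- A non-expanding `FP` string function (a projection of a record). [folklore] -/
structure Proj where
  /-- the function -/
  fn : List Bool → List Bool
  /-- it is polynomial time -/
  mem : fn ∈ FP
  /-- it does not expand -/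
  le : ∀ w, (fn w).length ≤ w.length

/-- `fstF` does not expand (a twin of `Lemma3FP.length_fstF_le` of `SharpSATNormalFormFP.lean`, which is
outside this file's imports). [folklore] -/
theorem length_fstF_le' (w : List Bool) : (fstF w).length ≤ w.length := by
  have h := length_boolUnpair_le w
  unfold fstF; omega

/-- `sndF` does not expand (a twin of `Lemma3FP.length_sndF_le`, outside this file's imports). [folklore] -/
theorem length_sndF_le' (w : List Bool) : (sndF w).length ≤ w.length := by
  have h := length_boolUnpair_le w
  unfold sndF; omega

namespace Proj

/-- The identity projection. [folklore] -/
def idP : Proj := ⟨fun w => w, PolyTimeComputable.id _, fun _ => le_rfl⟩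

/-- First field. [folklore] -/
def fstP : Proj := ⟨fstF, fstF_mem_FP, length_fstF_le'⟩

/-- Second field. [folklore] -/
def sndP : Proj := ⟨sndF, sndF_mem_FP, length_sndF_le'⟩

/-- Composition of projections. [folklore] -/
def comp (p q : Proj) : Proj := ⟨p.fn ∘ q.fn, comp_mem_FP p.mem q.mem, fun w => (p.le _).trans (q.le w)⟩

/-- Unfolding. [folklore] -/
@[simp] theorem idP_fn (w : List Bool) : idP.fn w = w := rfl
/-- Unfolding. [folklore] -/
@[simp] theorem fstP_fn (w : List Bool) : fstP.fn w = fstF w := rfl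
/-- Unfolding. [folklore] -/
@[simp] theorem sndP_fn (w : List Bool) : sndP.fn w = sndF w := rfl
/-- Unfolding. [folklore] -/
@[simp] theorem comp_fn (p q : Proj) (w : List Bool) : (p.comp q).fn w = p.fn (q.fn w) := rfl

end Proj

namespace BFn

/-- A constant. [folklore] -/
def const (l : List Bool) : BFn := ⟨fun _ => l, const_mem_FP l, C l.length, fun _ => by simp⟩

/-- Unfolding. [folklore] -/
@[simp] theorem const_fn (l w : List Bool) : (const l).fn w = l := rfl

/-- Concatenation of two outputs. [folklore] -/
def app (F G : BFn) : BFn :=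
  ⟨appF ∘ fanoutFn F.fn G.fn, comp_mem_FP appF_mem_FP (fanoutFn_mem_FP F.mem G.mem), F.bd + G.bd, fun w => by
    simp only [Function.comp_apply, fanoutFn_apply, appF_boolPair, List.length_append, eval_add]
    exact Nat.add_le_add (F.le w) (G.le w)⟩

/-- Unfolding. [folklore] -/
@[simp] theorem app_fn (F G : BFn) (w : List Bool) : (F.app G).fn w = F.fn w ++ G.fn w := by
  simp [app, fanoutFn_apply]

/-- Precomposition with a projection. [folklore] -/
def pre (F : BFn) (p : Proj) : BFn :=
  ⟨F.fn ∘ p.fn, comp_mem_FP F.mem p.mem, F.bd, fun w => (F.le _).trans (TM2Iter.eval_mono F.bd (p.le w))⟩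

/-- Unfolding. [folklore] -/
@[simp] theorem pre_fn (F : BFn) (p : Proj) (w : List Bool) : (F.pre p).fn w = F.fn (p.fn w) := rfl

/-- The pair of two outputs. [folklore] -/
def pair (F G : BFn) : BFn :=
  ⟨fanoutFn F.fn G.fn, fanoutFn_mem_FP F.mem G.mem, C 2 * F.bd + C 2 + G.bd, fun w => by
    simp only [fanoutFn_apply, length_boolPair, eval_add, eval_mul, eval_C]
    have := F.le w; have := G.le w; omega⟩

/-- Unfolding. [folklore] -/
@[simp] theorem pair_fn (F G : BFn) (w : List Bool) : (F.pair G).fn w = boolPair (F.fn w) (G.fn w) := by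
  simp [pair, fanoutFn_apply]

/-- Any `FP` function, bundled with some polynomial bound of its output length. [cite: AroraBarak2009, §1.3 (a polynomial-time machine writes polynomially many symbols)] -/
def ofFP (f : List Bool → List Bool) (hf : f ∈ FP) : BFn :=
  ⟨f, hf, Classical.choose (exists_poly_length_le_of_mem_FP hf), Classical.choose_spec (exists_poly_length_le_of_mem_FP hf)⟩

/-- Unfolding. [folklore] -/
@[simp] theorem ofFP_fn (f : List Bool → List Bool) (hf : f ∈ FP) (w : List Bool) : (ofFP f hf).fn w = f w := rfl

end BFn

/-! ### Numeral expressions -/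

/-- Numeral expressions over variables `V`: constants, a polynomial of one variable, sums, products.
[folklore] -/
inductive NExpr (V : Type) where
  /-- a constant -/
  | cst (c : ℕ)
  /-- a polynomial of the value of a variable -/
  | pol (p : Polynomial ℕ) (x : V)
  /-- sum -/
  | add (a b : NExpr V)
  /-- product -/
  | mul (a b : NExpr V)

namespace NExpr

variable {V : Type}

/-- The value in an environment. [folklore] -/
def eval (env : V → ℕ) : NExpr V → ℕ
  | cst c => c
  | pol p x => p.eval (env x)
  | add a b => a.eval env + b.eval env
  | mul a b => a.eval env * b.eval env

/-- A variable. [folklore] -/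
def var (x : V) : NExpr V := pol X x

/-- Value of a constant. [folklore] -/
@[simp] theorem eval_cst (env : V → ℕ) (c : ℕ) : (cst c : NExpr V).eval env = c := rfl
/-- Value of a polynomial node. [folklore] -/
@[simp] theorem eval_pol (env : V → ℕ) (p : Polynomial ℕ) (x : V) : (pol p x).eval env = p.eval (env x) := rfl
/-- Value of a sum. [folklore] -/
@[simp] theorem eval_add' (env : V → ℕ) (a b : NExpr V) : (add a b).eval env = a.eval env + b.eval env := rfl
/-- Value of a product. [folklore] -/
@[simp] theorem eval_mul' (env : V → ℕ) (a b : NExpr V) : (mul a b).eval env = a.eval env * b.eval env := rfl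
/-- Value of a variable. [folklore] -/
@[simp] theorem eval_var (env : V → ℕ) (x : V) : (var x).eval env = env x := by simp [var]

/-- A polynomial majorant of the value in a common bound of the variables. [folklore] -/
def bound : NExpr V → Polynomial ℕ
  | cst c => C c
  | pol p _ => p
  | add a b => a.bound + b.bound
  | mul a b => a.bound * b.bound

/-- Values are below the majorant. [folklore] -/
theorem eval_le {env : V → ℕ} {U : ℕ} (hU : ∀ x, env x ≤ U) : ∀ e : NExpr V, e.eval env ≤ e.bound.eval U
  | cst c => by simp [eval, bound]
  | pol p x => by simpa [eval, bound] using TM2Iter.eval_mono p (hU x)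
  | add a b => by simp only [eval, bound, eval_add]; exact Nat.add_le_add (eval_le hU a) (eval_le hU b)
  | mul a b => by simp only [eval, bound, eval_mul]; exact Nat.mul_le_mul (eval_le hU a) (eval_le hU b)

/-- The variables mentioned. [folklore] -/
def vars : NExpr V → List V
  | cst _ => []
  | pol _ x => [x]
  | add a b => a.vars ++ b.vars
  | mul a b => a.vars ++ b.vars

/-- An expression does not see an update of a variable it does not mention. [folklore] -/
theorem eval_update_of_notMem [DecidableEq V] {x : V} (env : V → ℕ) (v : ℕ) :
    ∀ {e : NExpr V}, x ∉ e.vars → e.eval (Function.update env x v) = e.eval env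
  | cst c, _ => rfl
  | pol p y, h => by
    have hy : y ≠ x := fun hy => h (by simp [vars, hy])
    simp [eval, Function.update_of_ne hy]
  | add a b, h => by
    simp only [vars, List.mem_append, not_or] at h
    rw [eval, eval, eval_update_of_notMem env v h.1, eval_update_of_notMem env v h.2]
  | mul a b, h => by
    simp only [vars, List.mem_append, not_or] at h
    rw [eval, eval, eval_update_of_notMem env v h.1, eval_update_of_notMem env v h.2]

/-- The environment read off a string by the projections. [folklore] -/
def envOf (π : V → Proj) (w : List Bool) : V → ℕ := fun x => ((π x).fn w).length

/-- The numeral of the value, as a string function. [folklore] -/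
def toFn (π : V → Proj) : NExpr V → (List Bool → List Bool)
  | cst c => fun _ => encodeNat c
  | pol p x => lenBinF ∘ polyFn p ∘ (π x).fn
  | add a b => addFn ∘ fanoutFn (toFn π a) (toFn π b)
  | mul a b => prodFn ∘ fanoutFn (toFn π a) (toFn π b)

/-- `toFn π e ∈ FP`. [cite: AroraBarak2009, §1.3 (arithmetic in polynomial time)] -/
theorem toFn_mem_FP (π : V → Proj) : ∀ e : NExpr V, toFn π e ∈ FP
  | cst c => by rw [toFn]; exact const_mem_FP _
  | pol p x => by rw [toFn]; exact comp_mem_FP lenBinF_mem_FP (comp_mem_FP (polyFn_mem_FP p) (π x).mem)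
  | add a b => by rw [toFn]; exact comp_mem_FP addFn_mem_FP (fanoutFn_mem_FP (toFn_mem_FP π a) (toFn_mem_FP π b))
  | mul a b => by rw [toFn]; exact comp_mem_FP prodFn_mem_FP (fanoutFn_mem_FP (toFn_mem_FP π a) (toFn_mem_FP π b))

/-- A polynomial majorant of the length of the printed numeral. [folklore] -/
def lbd : NExpr V → Polynomial ℕ
  | cst c => C c
  | pol p _ => p
  | add a b => a.lbd + b.lbd + 1
  | mul a b => a.lbd + b.lbd

/-- **The printed numeral is the numeral of the value.** [folklore] -/
theorem toFn_apply (π : V → Proj) (w : List Bool) : ∀ e : NExpr V, toFn π e w = encodeNat (e.eval (envOf π w))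
  | cst c => by rw [toFn]; rfl
  | pol p x => by rw [toFn]; simp [ones, envOf]
  | add a b => by
    rw [toFn, Function.comp_apply, fanoutFn_apply, toFn_apply π w a, toFn_apply π w b, addFn_boolPair, bitsToNat_encodeNat,
      bitsToNat_encodeNat]; rfl
  | mul a b => by
    rw [toFn, Function.comp_apply, fanoutFn_apply, toFn_apply π w a, toFn_apply π w b, prodFn_boolPair, bitsToNat_encodeNat,
      bitsToNat_encodeNat]; rfl

/-- The variables read off a string are bounded by its length. [folklore] -/
theorem envOf_le (π : V → Proj) (w : List Bool) (x : V) : envOf π w x ≤ w.length := (π x).le w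

/-- The printed numeral is short. [folklore] -/
theorem length_toFn_le (π : V → Proj) (w : List Bool) : ∀ e : NExpr V, (toFn π e w).length ≤ e.lbd.eval w.length
  | cst c => by rw [toFn_apply]; simpa [eval, lbd] using length_encodeNat_le_self c
  | pol p x => by
    rw [toFn_apply]
    simp only [eval, lbd]
    exact (length_encodeNat_le_self _).trans (TM2Iter.eval_mono p (envOf_le π w x))
  | add a b => by
    rw [toFn, Function.comp_apply, fanoutFn_apply]
    refine (length_addFn_le _).trans ?_
    rw [fstF_boolPair, sndF_boolPair]
    simp only [lbd, eval_add, eval_one]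
    have := length_toFn_le π w a; have := length_toFn_le π w b; omega
  | mul a b => by
    rw [toFn, Function.comp_apply, fanoutFn_apply]
    refine (length_prodFn_le _).trans ?_
    rw [fstF_boolPair, sndF_boolPair]
    simp only [lbd, eval_add]
    have := length_toFn_le π w a; have := length_toFn_le π w b; omega

/-- **The numeral of the value, as a bounded `FP` function.** [cite: AroraBarak2009, §1.3 (arithmetic in polynomial time)] -/
def toB (π : V → Proj) (e : NExpr V) : BFn := ⟨toFn π e, toFn_mem_FP π e, e.lbd, fun w => length_toFn_le π w e⟩

/-- Value of `toB`. [folklore] -/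
@[simp] theorem toB_fn (π : V → Proj) (e : NExpr V) (w : List Bool) : (toB π e).fn w = encodeNat (e.eval (envOf π w)) :=
  toFn_apply π w e

end NExpr

/-- **A unary count** `1^{q(|π w|)}`. [folklore] -/
def ucount (q : Polynomial ℕ) (p : Proj) : BFn :=
  ⟨polyFn q ∘ p.fn, comp_mem_FP (polyFn_mem_FP q) p.mem, q, fun w => by
    simp only [Function.comp_apply, polyFn_apply, ones, List.length_replicate]; exact TM2Iter.eval_mono q (p.le w)⟩

/-- Value of `ucount`. [folklore] -/
@[simp] theorem ucount_fn (q : Polynomial ℕ) (p : Proj) (w : List Bool) : (ucount q p).fn w = ones (q.eval (p.fn w).length) := by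
  simp [ucount]

/-! ### Gate words on numerals -/

/-- The word of a one-wire gate with symbol code `s` on the wire whose numeral `A` prints:
`gatePre s 1 ++ ⟨⟨A, []⟩, []⟩ = gateBits s 1 [wire]`. [cite: AroraBarak2009, §6.1 (descriptions of circuits)] -/
def gate1 (s : ℕ) (A : BFn) : BFn :=
  (BFn.const (gatePre s 1)).app ((A.pair (BFn.const [])).pair (BFn.const []))

/-- `gateBits s 1 [p]` through `boolPair`. [folklore] -/
theorem gateBits_one (s p : ℕ) : gateBits s 1 [p] = gatePre s 1 ++ boolPair (boolPair (encodeNat p) []) [] := by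
  rw [RevDesc.boolPair_eq, RevDesc.boolPair_eq]
  simp [gateBits, wireBits, ← dbl_dbl_encodeNat, List.append_assoc]

/-- **The one-wire word prints `gateBits s 1 [p]`.** [folklore] -/
theorem gate1_apply (s : ℕ) {A : BFn} {w : List Bool} {p : ℕ} (hA : A.fn w = encodeNat p) : (gate1 s A).fn w = gateBits s 1 [p] := by
  rw [gateBits_one]; simp [gate1, hA]

/-- **The word of `H` on a wire**: `gateEnc (hOn i)`. [cite: NielsenChuang2010, §4.2 (the Hadamard gate)] -/
def hWord (A : BFn) : BFn := gate1 0 A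

/-- `hWord` prints the description of `hOn`. [folklore] -/
theorem hWord_apply {A : BFn} {w : List Bool} {N : ℕ} (i : Fin N) (hA : A.fn w = encodeNat i) : (hWord A).fn w = gateEnc (hOn i) := by
  rw [gateEnc_hOn, hWord, gate1_apply 0 hA]

/-- **The word of `NOT` on a wire** (`X = H S S H`): `opBits (ClOp.not p)`. [cite: NielsenChuang2010, §4.3 Fig. 4.9] -/
def notWord (A : BFn) : BFn := ((gate1 0 A).app (gate1 1 A)).app ((gate1 1 A).app (gate1 0 A))

/-- `notWord` prints `opBits (ClOp.not p)`. [folklore] -/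
theorem notWord_apply {A : BFn} {w : List Bool} {p : ℕ} (hA : A.fn w = encodeNat p) : (notWord A).fn w = opBits (ClOp.not p) := by
  have h : opBits (ClOp.not p) = gateBits 0 1 [p] ++ gateBits 1 1 [p] ++ (gateBits 1 1 [p] ++ gateBits 0 1 [p]) := by
    simp [opBits, agates, AGate.bits, symCode, symArity]
  rw [h, notWord, BFn.app_fn, BFn.app_fn, BFn.app_fn, gate1_apply 0 hA, gate1_apply 1 hA]

/-- **The word of `CNOT p q`**: `gatePre 3 2 ++ ⟨⟨bin p, []⟩ ++ ⟨bin q, []⟩, []⟩`. [cite: AroraBarak2009, §6.1] -/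
def cnotWord (A B : BFn) : BFn :=
  (BFn.const (gatePre 3 2)).app ⟨fanoutFn (appF ∘ fanoutFn (fanoutFn A.fn fun _ => []) (fanoutFn B.fn fun _ => [])) fun _ => [],
    fanoutFn_mem_FP (comp_mem_FP appF_mem_FP (fanoutFn_mem_FP (fanoutFn_mem_FP A.mem (const_mem_FP _)) (fanoutFn_mem_FP B.mem (const_mem_FP _))))
      (const_mem_FP _), C 4 * A.bd + C 4 * B.bd + C 10, fun w => by
      simp only [fanoutFn_apply, Function.comp_apply, appF_boolPair, length_boolPair, List.length_append, List.length_nil,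
        eval_add, eval_mul, eval_C]
      have := A.le w; have := B.le w; omega⟩

/-- `cnotWord` prints `opBits (ClOp.cnot p q)`. [folklore] -/
theorem cnotWord_apply {A B : BFn} {w : List Bool} {p q : ℕ} (hA : A.fn w = encodeNat p) (hB : B.fn w = encodeNat q) :
    (cnotWord A B).fn w = opBits (ClOp.cnot p q) := by
  rw [SwapDesc.opBits_cnot]; simp [cnotWord, fanoutFn_apply, hA, hB]

/-- **The three words of a swapped pair** `(p, q)`: `CNOT p q; CNOT q p; CNOT p q`. [cite: NielsenChuang2010, §1.3.4 (swap from three CNOTs)] -/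
def swapWord (A B : BFn) : BFn := (cnotWord A B).app ((cnotWord B A).app (cnotWord A B))

/-- `swapWord` prints the `opBits` of the three `CNOT`s. [folklore] -/
theorem swapWord_apply {A B : BFn} {w : List Bool} {p q : ℕ} (hA : A.fn w = encodeNat p) (hB : B.fn w = encodeNat q) :
    (swapWord A B).fn w = opBits (ClOp.cnot p q) ++ (opBits (ClOp.cnot q p) ++ opBits (ClOp.cnot p q)) := by
  simp only [swapWord, BFn.app_fn, cnotWord_apply hA hB, cnotWord_apply hB hA]

/-! ### Layers: counted concatenations of pieces -/

/-- Length of a concatenation of pieces that are short below the count. [folklore] -/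
theorem length_ccat_le_of_lt (g : ℕ → List Bool) (b : ℕ) : ∀ {n : ℕ}, (∀ i, i < n → (g i).length ≤ b) → (ccat g n).length ≤ n * b
  | 0, _ => by simp
  | n + 1, h => by
    rw [ccat_succ, List.length_append, Nat.succ_mul]
    exact Nat.add_le_add (length_ccat_le_of_lt g b (fun i hi => h i (by omega))) (h n (by omega))

namespace BFn

/-- The clip polynomial of a layer: the bound of the piece at `|⟨x, 1ᵗ⟩| ≤ 2|x| + 2 + rounds`. [folklore] -/
def clipPoly (F cnt : BFn) : Polynomial ℕ := F.bd.comp (C 2 * X + C 2 + cnt.bd)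

/-- The pieces actually folded are within the clip. [folklore] -/
theorem piece_le (F cnt : BFn) (x : List Bool) {t : ℕ} (ht : t < (cnt.fn x).length) :
    (F.fn (boolPair x (ones t))).length ≤ (clipPoly F cnt).eval x.length := by
  refine (F.le _).trans ?_
  rw [clipPoly, eval_comp]
  refine TM2Iter.eval_mono F.bd ?_
  simp only [length_boolPair, ones, List.length_replicate, eval_add, eval_mul, eval_C, eval_X]
  have := cnt.le x; omega

/-- The layer function: the concatenation fold of the pieces over the count. [folklore] -/
def layerFn (F cnt : BFn) : List Bool → List Bool := foldCat (clipPoly F cnt) cnt.bd F.fn ∘ fanoutFn (fun x => x) cnt.fn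

/-- **The layer function is the `ccat` of the pieces.** [folklore] -/
theorem layerFn_apply (F cnt : BFn) (x : List Bool) :
    layerFn F cnt x = ccat (fun t => F.fn (boolPair x (ones t))) (cnt.fn x).length := by
  simp only [layerFn, Function.comp_apply, fanoutFn_apply]
  exact foldCat_apply (cnt.le x) (fun t ht => piece_le F cnt x ht)

/-- **The layer of pieces `F ⟨x, 1ᵗ⟩`, `t < |cnt x|`**, bundled. [cite: AroraBarak2009, §1.3 (bounded loops)] -/
def layer (F cnt : BFn) : BFn :=
  ⟨layerFn F cnt, comp_mem_FP (foldCat_mem_FP _ _ F.mem) (fanoutFn_mem_FP (PolyTimeComputable.id _) cnt.mem),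
    cnt.bd * clipPoly F cnt, fun x => by
      rw [layerFn_apply, eval_mul]
      exact (length_ccat_le_of_lt _ _ (fun t ht => piece_le F cnt x ht)).trans (Nat.mul_le_mul_right _ (cnt.le x))⟩

/-- Value of a layer. [folklore] -/
@[simp] theorem layer_fn (F cnt : BFn) (x : List Bool) :
    (layer F cnt).fn x = ccat (fun t => F.fn (boolPair x (ones t))) (cnt.fn x).length := layerFn_apply F cnt x

end BFn

/-! ### The zone gadgets describe as layers -/

/-- **A zone swap describes as the `ccat` of its swapped pairs.** [folklore] -/
theorem flatMap_opBits_swapZ (a b len : ℕ) :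
    (swapZ a b len).flatMap opBits =
      ccat (fun j => opBits (ClOp.cnot (a + j) (b + j)) ++ (opBits (ClOp.cnot (b + j) (a + j)) ++ opBits (ClOp.cnot (a + j) (b + j)))) len := by
  rw [swapZ, zonePairs, RevMux.swapOps, List.flatMap_assoc, List.flatMap_map, CWrap.flatMap_range_eq_ccat]
  exact ccat_congr fun j _ => by simp

/-- **A run of `NOT`s describes as the `ccat` of its words.** [folklore] -/
theorem flatMap_opBits_notsZ (a len : ℕ) : (notsZ a len).flatMap opBits = ccat (fun j => opBits (ClOp.not (a + j))) len := by
  rw [notsZ, List.flatMap_map, CWrap.flatMap_range_eq_ccat]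

/-- **A copy layer describes as the `ccat` of its words.** [folklore] -/
theorem flatMap_opBits_copyZ (src : ℕ → ℕ) (a len : ℕ) :
    (copyZ src a len).flatMap opBits = ccat (fun j => opBits (ClOp.cnot (src j) (a + j))) len := by
  rw [copyZ, copyOps, List.map_map, List.flatMap_map, CWrap.flatMap_range_eq_ccat]
  exact ccat_congr fun j _ => rfl

/-! ### Branching on a length comparison -/

namespace BFn

/-- **`if |U x| < |W x| then F x else G x`.** [cite: AroraBarak2009, §1.3] -/
def iteLt (U W F G : BFn) : BFn :=
  ⟨iteFn (ltLenF ∘ fanoutFn U.fn W.fn) F.fn G.fn,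
    iteFn_mem_FP (comp_mem_FP ltLenF_mem_FP (fanoutFn_mem_FP U.mem W.mem)) F.mem G.mem,
    F.bd + G.bd, fun w => by
      have hc : (ltLenF ∘ fanoutFn U.fn W.fn) w = [decide ((U.fn w).length < (W.fn w).length)] := by simp [fanoutFn_apply]
      rw [iteFn_apply hc, eval_add]
      split_ifs
      · exact (F.le w).trans (Nat.le_add_right _ _)
      · exact (G.le w).trans (Nat.le_add_left _ _)⟩

/-- Value of `iteLt`. [folklore] -/
theorem iteLt_fn (U W F G : BFn) (w : List Bool) :
    (iteLt U W F G).fn w = if (U.fn w).length < (W.fn w).length then F.fn w else G.fn w := by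
  have hc : (ltLenF ∘ fanoutFn U.fn W.fn) w = [decide ((U.fn w).length < (W.fn w).length)] := by simp [fanoutFn_apply]
  change iteFn _ _ _ w = _
  rw [iteFn_apply hc]
  by_cases h : (U.fn w).length < (W.fn w).length <;> simp [h]

end BFn

/-! ### Layers across one record level -/

section Levels

variable {V : Type} [DecidableEq V] (πo πi : V → Proj) (xi : V)

variable {πo πi xi}

/-- The numeral of `a(r) + t` printed at the inner level, **when the projections of the two record
levels are compatible**: reading `⟨r, 1ᵗ⟩` at the inner level is reading `r` at the outer level with
the index variable set to `t` (hypothesis `h`, here and below). [folklore] -/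
theorem toB_add_var_fn (h : ∀ r t, NExpr.envOf πi (boolPair r (ones t)) = Function.update (NExpr.envOf πo r) xi t) {aE : NExpr V} (ha : xi ∉ aE.vars) (r : List Bool) (t : ℕ) :
    (NExpr.toB πi (.add aE (.var xi))).fn (boolPair r (ones t)) = encodeNat (aE.eval (NExpr.envOf πo r) + t) := by
  rw [NExpr.toB_fn, h r t]
  simp [NExpr.eval_update_of_notMem _ _ ha]

variable (πo πi xi)

/-- **The swap layer** of the zones at `a(r)`, `b(r)` of length `q(v(r))`. [cite: NielsenChuang2010, §1.3.4] -/
def swapL (aE bE : NExpr V) (q : Polynomial ℕ) (v : V) : BFn :=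
  BFn.layer (swapWord (NExpr.toB πi (.add aE (.var xi))) (NExpr.toB πi (.add bE (.var xi)))) (ucount q (πo v))

/-- **The `NOT` layer** at `a(r)` of length `q(v(r))`. [folklore] -/
def notsL (aE : NExpr V) (q : Polynomial ℕ) (v : V) : BFn :=
  BFn.layer (notWord (NExpr.toB πi (.add aE (.var xi)))) (ucount q (πo v))

/-- **The copy layer** from the sources printed by `S` onto the zone at `a(r)` of length `q(v(r))`. [folklore] -/
def copyLB (S : BFn) (aE : NExpr V) (q : Polynomial ℕ) (v : V) : BFn :=
  BFn.layer (cnotWord S (NExpr.toB πi (.add aE (.var xi)))) (ucount q (πo v))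

/-- **The Hadamard layer** on the wires `a(r) + t`, `t < q(v(r))`. [cite: NielsenChuang2010, §1.4.4] -/
def hL (aE : NExpr V) (q : Polynomial ℕ) (v : V) : BFn :=
  BFn.layer (hWord (NExpr.toB πi (.add aE (.var xi)))) (ucount q (πo v))

variable {πo πi xi}

omit [DecidableEq V] in
/-- The count of a layer. [folklore] -/
theorem length_ucount_fn (q : Polynomial ℕ) (v : V) (r : List Bool) :
    ((ucount q (πo v)).fn r).length = q.eval (NExpr.envOf πo r v) := by
  simp [ones, NExpr.envOf]

/-- **The swap layer prints `swapZ`.** [folklore] -/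
theorem swapL_fn (h : ∀ r t, NExpr.envOf πi (boolPair r (ones t)) = Function.update (NExpr.envOf πo r) xi t) {aE bE : NExpr V} (ha : xi ∉ aE.vars) (hb : xi ∉ bE.vars) (q : Polynomial ℕ) (v : V) (r : List Bool) :
    (swapL πo πi xi aE bE q v).fn r =
      (swapZ (aE.eval (NExpr.envOf πo r)) (bE.eval (NExpr.envOf πo r)) (q.eval (NExpr.envOf πo r v))).flatMap opBits := by
  rw [flatMap_opBits_swapZ, swapL, BFn.layer_fn, length_ucount_fn]
  exact ccat_congr fun t _ => swapWord_apply (toB_add_var_fn h ha r t) (toB_add_var_fn h hb r t)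

/-- **The `NOT` layer prints `notsZ`.** [folklore] -/
theorem notsL_fn (h : ∀ r t, NExpr.envOf πi (boolPair r (ones t)) = Function.update (NExpr.envOf πo r) xi t) {aE : NExpr V} (ha : xi ∉ aE.vars) (q : Polynomial ℕ) (v : V) (r : List Bool) :
    (notsL πo πi xi aE q v).fn r = (notsZ (aE.eval (NExpr.envOf πo r)) (q.eval (NExpr.envOf πo r v))).flatMap opBits := by
  rw [flatMap_opBits_notsZ, notsL, BFn.layer_fn, length_ucount_fn]
  exact ccat_congr fun t _ => notWord_apply (toB_add_var_fn h ha r t)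

/-- **The copy layer prints `copyZ`.** [folklore] -/
theorem copyLB_fn (h : ∀ r t, NExpr.envOf πi (boolPair r (ones t)) = Function.update (NExpr.envOf πo r) xi t) {S : BFn} {src : ℕ → ℕ} {r : List Bool} (hS : ∀ t, S.fn (boolPair r (ones t)) = encodeNat (src t))
    {aE : NExpr V} (ha : xi ∉ aE.vars) (q : Polynomial ℕ) (v : V) :
    (copyLB πo πi xi S aE q v).fn r = (copyZ src (aE.eval (NExpr.envOf πo r)) (q.eval (NExpr.envOf πo r v))).flatMap opBits := by
  rw [flatMap_opBits_copyZ, copyLB, BFn.layer_fn, length_ucount_fn]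
  exact ccat_congr fun t _ => cnotWord_apply (hS t) (toB_add_var_fn h ha r t)

/-- **The Hadamard layer prints the words `gateBits 0 1 [a + t]`.** [folklore] -/
theorem hL_fn (h : ∀ r t, NExpr.envOf πi (boolPair r (ones t)) = Function.update (NExpr.envOf πo r) xi t) {aE : NExpr V} (ha : xi ∉ aE.vars) (q : Polynomial ℕ) (v : V) (r : List Bool) :
    (hL πo πi xi aE q v).fn r = ccat (fun t => gateBits 0 1 [aE.eval (NExpr.envOf πo r) + t]) (q.eval (NExpr.envOf πo r v)) := by
  rw [hL, BFn.layer_fn, length_ucount_fn]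
  exact ccat_congr fun t _ => by rw [hWord, gate1_apply 0 (toB_add_var_fn h ha r t)]

end Levels

end GadgetDesc

end Literature.Computability.QuantumComplexity

end
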